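import Mathlib.Analysis.SpecialFunctions.Log.Basic
import Mathlib.Analysis.SpecialFunctions.Pow.Real
import Mathlib.Data.Nat.Squarefree
import Mathlib.Algebra.Order.BigOperators.Ring.Finset
import Mathlib.Algebra.BigOperators.Ring.Finset
import HarnessLib

/-!
# Selberg's lower-bound sieve of irregular density: `J · W ≥ ν`
# (Friedlander–Iwaniec, Acta Arith. 209 (2023), Lemma 2.1, Theorem 1, and §5 (5.3)–(5.4)) — PROVED

Topic `Literature/NumberTheory/Sieve`, namespace `Literature.NumberTheory.Sieve.SelbergIrregular`.
Companion of `Literature/NumberTheory/LFunctions/ExceptionalZeroProgressionLowerBound.lean` (the same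
paper's Corollary 6.1, a named fact) — this file formalises the SIEVE half of the paper (§§1–3, §5 up
to (5.4)) and PROVES it: no named fact is introduced. Typed by the cross-ladder literature-typing seat
`littype-FP2-2` for the cells `parity-realchar` and `landau-siegel`.

Source: J. B. Friedlander, H. Iwaniec, *Selberg's sieve of irregular density*, Acta Arith. **209**
(2023) 385–396 = arXiv:2206.03479 [FriedlanderIwaniec2023SelbergIrregular] (held; §§1–6 read).

## What the source says

With `g` "a multiplicative function (called the density) satisfying (1.4) `0 ≤ g(p) < 1`", `h` the
multiplicative function with (1.8) `h(p) = g(p)/(1 − g(p))`, the Selberg lower-bound weights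
`ρ_d` (supported on squarefree `d ≤ Δ`, (2.9)) in the diagonal variables (2.6) `y_d`, the choice (2.11)
`y_d = H⁻¹ log(Δ/d)` with (2.12) `H = Σ♭_{d≤Δ} h(d) log(Δ/d)`, the main term `W` of (2.3)/(2.4) becomes
((2.8) = [Opera de Cribro, (7.109)], (2.15)–(2.16))
  `H² W = K(Δ) − Σ_{p<z} g(p) Σ_{d<Δ, (d,p)=1} h(d) {min(log p, log(Δ/d))}²`,
  (2.17) `K(u) = Σ_{d≤u} h(d) (log(Δ/d))²`;
(2.19) `α = log w/log Δ`, (2.21) `J(w, Δ) = Σ_{w<d≤Δ} h(d)`, (2.23) `G(w) = Σ_{p≤w} g(p)(log p)²`.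
**Lemma 2.1.** "Let `z > w ≥ 2` and `Δ ≥ w³`. We have
(2.22) `H²W ≥ (1 − Σ_{w<p≤z} g(p)) K − (9/2) α² K(w²) − J(w, Δ) G(w)`."
**Assumption 1** (3.1): `G(w) ≤ (3/2)(log w)²`. **Assumption 2** (3.3): `J(w, Δ)(log Δ)² ≤ 3 K(w², Δ)`,
where (3.2) `K(w², Δ) = K(Δ) − K(w²)`. (3.6) `ν = 1 − Σ_{w<p≤z} g(p) − (9/2)α²`.
**THEOREM 1.** "Let `Δ ≥ w³` and `g(d)` be such that (3.1) and (3.3) hold. If `z > w` and `ν > 0`,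
then (3.7) `J W ≥ ν`." ("Then `W` is positive and we can apply the inequality `H² ≤ JK`".)
§5, (5.2)–(5.4): with `Δ = w³`, `z = √x ≥ w³` and **Assumption 3** `δ(w, √x) = Σ_{w<p≤√x} g(p) ≤ 1/4`,
"`ν = 1 − δ(w, √x) − 1/2 ≥ 1/4`, so that (3.7) implies `W ≥ (1/4) V`, where (5.4)
`V = ∏_{p<w³} (1 − g(p))`" (via (1.9): `J ≤ ∏ (1 + h(p)) = V⁻¹`).

## How it is typed, and two points of reading (recorded, not silent)

* All objects are FINITE sums and are DEFINED here with bodies, for an arbitrary `g : ℕ → ℝ` (only its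
  values at primes enter): `hWeight g d = ∏_{p ∣ d} g(p)/(1 − g(p))` (= `h(d)` on squarefree `d`),
  `J`, `H`, `K`, `Kle`/`Kgt` (= `K(u)` and `K(u, Δ)` for `u ≤ Δ`), `T` (the prime sum of (2.16)),
  **`W g Δ z = (K − T)/H²` — i.e. `W` is DEFINED by (2.16)** (the value of Selberg's quadratic form
  (2.4) at the weights (2.11), by (2.8) = Opera de Cribro (7.109); that identity and the sieve inequality
  (2.1)–(2.3) `S(𝒜, z) ≥ X W + 𝓡` are NOT formalised here), `G`, `Jtail` (= `J(w, Δ)`), `primeSum`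
  (= `Σ_{w<p≤z} g(p)`), `alpha`, `nu`, `Assumption1`, `Assumption2`, `IsDensity` (= (1.4) at primes).
* READING 1 (the `J` of Theorem 1). (1.7) defines `J = Σ_{d≤Δ, d∣P(z)} h(d)`, but the proof of
  Theorem 1 uses "`H² ≤ JK` by Cauchy's inequality" with `H`, `K` summed over ALL squarefree `d ≤ Δ`
  ((2.9): "We could apply the stronger conditions `d ≤ Δ`, `d ∣ P(z)` which we omit"), which is Cauchy
  for `J = Σ♭_{d≤Δ} h(d)`. We therefore type `J g Δ = Σ♭_{d≤Δ} h(d)`; it coincides with (1.7) whenever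
  `Δ ≤ z` (every squarefree `d ≤ Δ` then divides `P(z)` up to the prime `d = z`), which is the case
  in §5 (`Δ = w³ ≤ √x = z`). With (1.7)'s `J` and `Δ > z` the printed inequality would be STRONGER than
  what the printed proof gives; we do not assert it.
* READING 2 (a repaired step in Lemma 2.1). On p. 389 the contribution of `p ≤ w`, `d ≤ w` is bounded
  via "`(log w)(log d) ≤ ½ (3α log(Δ/d))²` if `Δ ≥ w³`", which FAILS termwise for `d` near `w²` (e.g.
  `Δ = w³`, `d = w²`: `2(log w)² ≰ ½(log w)²`). The conclusion survives: that contribution is EXACTLY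
  `Σ_{p≤w} g(p)(log p)² Σ♭_{d≤w,(d,p)=1} h(d) ≤ G(w) · Σ♭_{d≤w} h(d)` and
  `Σ♭_{d≤w} h(d) · (log Δ − log w)² ≤ K(w) ≤ K(w²)` with `log Δ − log w ≥ (2/3) log Δ`, so UNDER
  ASSUMPTION 1 it is `≤ (3/2)(9/4) α² K(w²) = (27/8) α² K(w²) ≤ (9/2) α² K(w²)`. We therefore prove
  Lemma 2.1 in the form `lemma21` WITH Assumption (3.1) among its hypotheses (Theorem 1 assumes (3.1)
  anyway, so THEOREM 1 IS PROVED EXACTLY AS PRINTED, under Reading 1); the assumption-free (2.22) is not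
  asserted. (Numerically (2.22) held with a wide margin in every toy density we tried; we simply do not
  need it.) Our `lemma21` has `Σ_{w<p<z}` (as in (2.18)); the printed `Σ_{w<p≤z}` version is weaker and
  is `lemma21'`.
* (5.4): we prove `W ≥ ν · ∏_{p ≤ Δ} (1 − g(p))` (`theorem1_W_ge`) and, for `Δ = w³` and
  `Σ_{w<p≤z} g(p) ≤ 1/4`, **`W ≥ (1/4) ∏_{p ≤ w³} (1 − g(p))`** (`W_ge_quarter_prod`); the product over
  `p ≤ w³` equals the printed `∏_{p < w³}` unless `w³` is a prime (never, for the integer `w = q³` of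
  §5), and is `≤` it in general (safe direction).
* Proposition 5.1 and Corollary 6.1 additionally use the sieve inequality (2.1)–(2.3) with the remainder
  bound (2.14) and [Opera de Cribro, (24.20)]; Proposition 5.1 is NOT typed here (its "`− R log x`"
  carries the absolute implied constant of (5.6)); Corollary 6.1 is the named fact
  `Literature.NumberTheory.LFunctions.friedlanderIwaniec2023_corollary61`.

## Contents (all PROVED; no `sorry`, no named fact)

* definitions as above; `hWeight_nonneg`, `hWeight_one`, `K_pos`, `H_pos`;
* `lemma21` / `lemma21'` — Lemma 2.1 under (1.4), `2 ≤ w < z`, `w³ ≤ Δ` and Assumption 1;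
* `theorem1` — **Theorem 1: `ν ≤ J · W`**; `W_pos`;
* `J_le_inv_prod` — (1.9): `J ≤ (∏_{p≤Δ} (1 − g(p)))⁻¹`; `theorem1_W_ge` — `ν ∏_{p≤Δ}(1 − g(p)) ≤ W`;
* `W_ge_quarter_prod` — §5 (5.3)–(5.4): `Δ = w³`, `Σ_{w<p≤z} g(p) ≤ 1/4` ⇒ `(1/4) ∏_{p≤w³}(1 − g(p)) ≤ W`.

## References

* [FriedlanderIwaniec2023SelbergIrregular] J. B. Friedlander, H. Iwaniec, Acta Arith. 209 (2023)
  385–396: §1 (1.4), (1.7)–(1.10); §2 (2.8)–(2.23), Lemma 2.1; §3 (3.1)–(3.7), Theorem 1; §5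
  (5.1)–(5.4).
* [FriedlanderIwaniec2010] *Opera de Cribro*, AMS Colloq. Publ. 57 (2010), (7.109) (the diagonal form
  of Selberg's lower-bound quadratic form).
-/

noncomputable section

open Finset Real

namespace Literature.NumberTheory.Sieve

namespace SelbergIrregular

/-! ### Index sets -/

/-- The squarefree integers `1 ≤ d ≤ u` (the support (2.9) of the sieve weights, `u = Δ`).
[cite: FriedlanderIwaniec2023SelbergIrregular, §2 (2.9)] -/
def sqf (u : ℝ) : Finset ℕ := (Finset.Icc 1 ⌊u⌋₊).filter Squarefree

/-- The primes `p ≤ u`. [cite: FriedlanderIwaniec2023SelbergIrregular, §2 (2.23)] -/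
def primesLe (u : ℝ) : Finset ℕ := (Finset.Icc 1 ⌊u⌋₊).filter Nat.Prime

/-- The primes `p < u` (as in `p < z`, `p ∣ P(z)`). [cite: FriedlanderIwaniec2023SelbergIrregular, §1 (1.1)] -/
def primesLt (u : ℝ) : Finset ℕ := (Finset.range ⌈u⌉₊).filter Nat.Prime

/-- Membership in `sqf u`. [folklore] -/
private theorem mem_sqf {u : ℝ} {d : ℕ} : d ∈ sqf u ↔ (1 ≤ d ∧ d ≤ ⌊u⌋₊) ∧ Squarefree d := by
  simp [sqf, Finset.mem_Icc]

/-- `d ∈ sqf u ⇒ 1 ≤ d`. [folklore] -/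
private theorem one_le_of_mem_sqf {u : ℝ} {d : ℕ} (hd : d ∈ sqf u) : 1 ≤ d := (mem_sqf.mp hd).1.1

/-- `d ∈ sqf u ⇒ d ≤ u`. [folklore] -/
private theorem cast_le_of_mem_sqf {u : ℝ} (hu : 0 ≤ u) {d : ℕ} (hd : d ∈ sqf u) : (d : ℝ) ≤ u :=
  le_trans (by exact_mod_cast (mem_sqf.mp hd).1.2) (Nat.floor_le hu)

/-- `1 ∈ sqf u` for `u ≥ 1`. [folklore] -/
private theorem one_mem_sqf {u : ℝ} (hu : 1 ≤ u) : 1 ∈ sqf u :=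
  mem_sqf.mpr ⟨⟨le_rfl, Nat.le_floor (by simpa using hu)⟩, squarefree_one⟩

/-- For `d` in the support, `0 ≤ log(Δ/d)` (as `1 ≤ d ≤ Δ`). [folklore] -/
private theorem log_div_nonneg {Δ : ℝ} (hΔ : 0 ≤ Δ) {d : ℕ} (hd : d ∈ sqf Δ) : 0 ≤ Real.log (Δ / d) := by
  have hd1 : (1 : ℝ) ≤ d := by exact_mod_cast one_le_of_mem_sqf hd
  apply Real.log_nonneg
  rw [le_div_iff₀ (by linarith)]
  simpa using cast_le_of_mem_sqf hΔ hd

/-! ### The density and the weight `h` -/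

/-- (1.4): `0 ≤ g(p) < 1` at every prime (the only values of the density `g` that enter); a
predicate on `g`, not a named fact. [cite: FriedlanderIwaniec2023SelbergIrregular, §1 (1.4)] -/
def IsDensity (g : ℕ → ℝ) : Prop := ∀ p : ℕ, p.Prime → 0 ≤ g p ∧ g p < 1

variable (g : ℕ → ℝ)

/-- (1.8): `h(d) = ∏_{p ∣ d} g(p)/(1 − g(p))` — the multiplicative function with
`h(p) = g(p)/(1 − g(p))`, evaluated on squarefree `d` (the only arguments used).
[cite: FriedlanderIwaniec2023SelbergIrregular, §1 (1.8)] -/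
def hWeight (d : ℕ) : ℝ := ∏ p ∈ d.primeFactors, g p / (1 - g p)

/-- `J = Σ♭_{d ≤ Δ} h(d)` — the `J` of the Cauchy step "`H² ≤ JK`" in the proof of Theorem 1 (all
squarefree `d ≤ Δ`, the support (2.9)); equal to (1.7) `Σ_{d≤Δ, d∣P(z)} h(d)` when `Δ ≤ z` (§5). See the
module docstring, Reading 1. [cite: FriedlanderIwaniec2023SelbergIrregular, §1 (1.7) and §3 (proof of Theorem 1)] -/
def J (Δ : ℝ) : ℝ := ∑ d ∈ sqf Δ, hWeight g d

/-- (2.12): `H = Σ♭_{d≤Δ} h(d) log(Δ/d)`. [cite: FriedlanderIwaniec2023SelbergIrregular, §2 (2.12)] -/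
def H (Δ : ℝ) : ℝ := ∑ d ∈ sqf Δ, hWeight g d * Real.log (Δ / d)

/-- (2.17) at `u = Δ`: `K = K(Δ) = Σ♭_{d≤Δ} h(d) (log(Δ/d))²`.
[cite: FriedlanderIwaniec2023SelbergIrregular, §2 (2.17)] -/
def K (Δ : ℝ) : ℝ := ∑ d ∈ sqf Δ, hWeight g d * Real.log (Δ / d) ^ 2

/-- (2.17)/(2.20) for `u ≤ Δ`: `K(u) = Σ♭_{d≤u} h(d) (log(Δ/d))²`.
[cite: FriedlanderIwaniec2023SelbergIrregular, §2 (2.17), (2.20)] -/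
def Kle (Δ u : ℝ) : ℝ :=
  ∑ d ∈ (sqf Δ).filter (fun d : ℕ => (d : ℝ) ≤ u), hWeight g d * Real.log (Δ / d) ^ 2

/-- (3.2): `K(u, Δ) = K(Δ) − K(u) = Σ♭_{u<d≤Δ} h(d) (log(Δ/d))²`.
[cite: FriedlanderIwaniec2023SelbergIrregular, §3 (3.2)] -/
def Kgt (Δ u : ℝ) : ℝ :=
  ∑ d ∈ (sqf Δ).filter (fun d : ℕ => ¬ (d : ℝ) ≤ u), hWeight g d * Real.log (Δ / d) ^ 2

/-- The prime sum of (2.16): `Σ_{p<z} g(p) Σ♭_{d≤Δ, (d,p)=1} h(d) {min(log p, log(Δ/d))}²`.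
[cite: FriedlanderIwaniec2023SelbergIrregular, §2 (2.16)] -/
def T (Δ z : ℝ) : ℝ :=
  ∑ p ∈ primesLt z, g p *
    ∑ d ∈ (sqf Δ).filter (fun d : ℕ => Nat.Coprime d p),
      hWeight g d * min (Real.log p) (Real.log (Δ / d)) ^ 2

/-- **The main term `W`**, DEFINED by (2.16): `W = (K(Δ) − Σ_{p<z} g(p) Σ♭ …)/H²` — the value of
Selberg's lower-bound quadratic form (2.4) at the weights (2.11) `y_d = H⁻¹ log(Δ/d)`, by (2.8)
(= Opera de Cribro (7.109)) and (2.15). [cite: FriedlanderIwaniec2023SelbergIrregular, §2 (2.16) with (2.8), (2.11), (2.15)] -/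
def W (Δ z : ℝ) : ℝ := (K g Δ - T g Δ z) / H g Δ ^ 2

/-- (2.23): `G(w) = Σ_{p≤w} g(p) (log p)²`. [cite: FriedlanderIwaniec2023SelbergIrregular, §2 (2.23)] -/
def G (w : ℝ) : ℝ := ∑ p ∈ primesLe w, g p * Real.log p ^ 2

/-- (2.21): `J(w, Δ) = Σ♭_{w<d≤Δ} h(d)`. [cite: FriedlanderIwaniec2023SelbergIrregular, §2 (2.21)] -/
def Jtail (w Δ : ℝ) : ℝ := ∑ d ∈ (sqf Δ).filter (fun d : ℕ => w < (d : ℝ)), hWeight g d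

/-- `Σ♭_{d≤w} h(d)` (the complement of `J(w, Δ)` in `J`; used in the repaired step of Lemma 2.1).
[cite: FriedlanderIwaniec2023SelbergIrregular, §2 (2.18)–(2.21)] -/
def Jle (w Δ : ℝ) : ℝ := ∑ d ∈ (sqf Δ).filter (fun d : ℕ => ¬ w < (d : ℝ)), hWeight g d

/-- `Σ_{w<p≤z} g(p)` (the sum in (2.22), (3.6); `= δ(w, z)` of (5.1)).
[cite: FriedlanderIwaniec2023SelbergIrregular, §3 (3.6), §5 (5.1)] -/
def primeSum (w z : ℝ) : ℝ := ∑ p ∈ (primesLe z).filter (fun p : ℕ => w < (p : ℝ)), g p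

/-- (2.19): `α = log w/log Δ`. [cite: FriedlanderIwaniec2023SelbergIrregular, §2 (2.19)] -/
def alpha (w Δ : ℝ) : ℝ := Real.log w / Real.log Δ

/-- (3.6): `ν = 1 − Σ_{w<p≤z} g(p) − (9/2) α²`. [cite: FriedlanderIwaniec2023SelbergIrregular, §3 (3.6)] -/
def nu (w z Δ : ℝ) : ℝ := 1 - primeSum g w z - 9 / 2 * alpha w Δ ^ 2

/-- **Assumption 1** (3.1): `G(w) ≤ (3/2)(log w)²`. [cite: FriedlanderIwaniec2023SelbergIrregular, §3 (3.1)] -/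
def Assumption1 (w : ℝ) : Prop := G g w ≤ 3 / 2 * Real.log w ^ 2

/-- **Assumption 2** (3.3): `J(w, Δ)(log Δ)² ≤ 3 K(w², Δ)`. [cite: FriedlanderIwaniec2023SelbergIrregular, §3 (3.3)] -/
def Assumption2 (w Δ : ℝ) : Prop := Jtail g w Δ * Real.log Δ ^ 2 ≤ 3 * Kgt g Δ (w ^ 2)

variable {g}

/-! ### Basic properties -/

/-- `h(d) ≥ 0` under (1.4). [cite: FriedlanderIwaniec2023SelbergIrregular, §1 (1.4), (1.8)] -/
theorem hWeight_nonneg (hg : IsDensity g) (d : ℕ) : 0 ≤ hWeight g d :=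
  Finset.prod_nonneg fun p hp => by
    obtain ⟨h0, h1⟩ := hg p (Nat.prime_of_mem_primeFactors hp)
    exact div_nonneg h0 (by linarith)

/-- `h(1) = 1`. [cite: FriedlanderIwaniec2023SelbergIrregular, §1 (1.8)] -/
theorem hWeight_one : hWeight g 1 = 1 := by simp [hWeight]

/-- `K = K(u) + K(u, Δ)` ((3.2)). [cite: FriedlanderIwaniec2023SelbergIrregular, §3 (3.2)] -/
theorem K_eq_Kle_add_Kgt (Δ u : ℝ) : K g Δ = Kle g Δ u + Kgt g Δ u := by
  rw [K, Kle, Kgt]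
  exact (Finset.sum_filter_add_sum_filter_not _ _ _).symm

/-- `J = Σ♭_{d≤w} h(d) + J(w, Δ)`. [cite: FriedlanderIwaniec2023SelbergIrregular, §2 (2.21)] -/
theorem J_eq_Jle_add_Jtail (w Δ : ℝ) : J g Δ = Jle g w Δ + Jtail g w Δ := by
  rw [J, Jle, Jtail, add_comm]
  exact (Finset.sum_filter_add_sum_filter_not _ _ _).symm

/-- `K ≥ (log Δ)² > 0` for `Δ > 1` (the term `d = 1`). [cite: FriedlanderIwaniec2023SelbergIrregular, §2 (2.17)] -/
theorem sq_log_le_K (hg : IsDensity g) {Δ : ℝ} (hΔ : 1 ≤ Δ) : Real.log Δ ^ 2 ≤ K g Δ := by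
  have h1 : hWeight g 1 * Real.log (Δ / (1 : ℕ)) ^ 2 = Real.log Δ ^ 2 := by
    rw [hWeight_one]; simp
  rw [← h1]
  exact Finset.single_le_sum (f := fun d => hWeight g d * Real.log (Δ / d) ^ 2)
    (fun d _ => mul_nonneg (hWeight_nonneg hg d) (sq_nonneg _)) (one_mem_sqf hΔ)

/-- `K > 0` for `Δ > 1`. [cite: FriedlanderIwaniec2023SelbergIrregular, §2 (2.17)] -/
theorem K_pos (hg : IsDensity g) {Δ : ℝ} (hΔ : 1 < Δ) : 0 < K g Δ :=
  lt_of_lt_of_le (pow_pos (Real.log_pos hΔ) 2) (sq_log_le_K hg hΔ.le)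

/-- `H ≥ log Δ > 0` for `Δ > 1`. [cite: FriedlanderIwaniec2023SelbergIrregular, §2 (2.12)] -/
theorem log_le_H (hg : IsDensity g) {Δ : ℝ} (hΔ : 1 ≤ Δ) : Real.log Δ ≤ H g Δ := by
  have h1 : hWeight g 1 * Real.log (Δ / (1 : ℕ)) = Real.log Δ := by
    rw [hWeight_one]; simp
  rw [← h1]
  exact Finset.single_le_sum (f := fun d => hWeight g d * Real.log (Δ / d))
    (fun d hd => mul_nonneg (hWeight_nonneg hg d) (log_div_nonneg (by linarith) hd)) (one_mem_sqf hΔ)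

/-- `H > 0` for `Δ > 1`. [cite: FriedlanderIwaniec2023SelbergIrregular, §2 (2.12)] -/
theorem H_pos (hg : IsDensity g) {Δ : ℝ} (hΔ : 1 < Δ) : 0 < H g Δ :=
  lt_of_lt_of_le (Real.log_pos hΔ) (log_le_H hg hΔ.le)

/-- `K(u) ≥ 0`. [cite: FriedlanderIwaniec2023SelbergIrregular, §2 (2.17)] -/
theorem Kle_nonneg (hg : IsDensity g) (Δ u : ℝ) : 0 ≤ Kle g Δ u :=
  Finset.sum_nonneg fun d _ => mul_nonneg (hWeight_nonneg hg d) (sq_nonneg _)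

/-- `K(u, Δ) ≥ 0`. [cite: FriedlanderIwaniec2023SelbergIrregular, §3 (3.2)] -/
theorem Kgt_nonneg (hg : IsDensity g) (Δ u : ℝ) : 0 ≤ Kgt g Δ u :=
  Finset.sum_nonneg fun d _ => mul_nonneg (hWeight_nonneg hg d) (sq_nonneg _)

/-- `Σ♭_{d≤w} h(d) ≥ 0`. [cite: FriedlanderIwaniec2023SelbergIrregular, §1 (1.4), (1.8)] -/
theorem Jle_nonneg (hg : IsDensity g) (w Δ : ℝ) : 0 ≤ Jle g w Δ :=
  Finset.sum_nonneg fun d _ => hWeight_nonneg hg d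

/-- `J(w, Δ) ≥ 0`. [cite: FriedlanderIwaniec2023SelbergIrregular, §2 (2.21)] -/
theorem Jtail_nonneg (hg : IsDensity g) (w Δ : ℝ) : 0 ≤ Jtail g w Δ :=
  Finset.sum_nonneg fun d _ => hWeight_nonneg hg d

/-- `Σ_{w<p≤z} g(p) ≥ 0`. [cite: FriedlanderIwaniec2023SelbergIrregular, §3 (3.6)] -/
theorem primeSum_nonneg (hg : IsDensity g) (w z : ℝ) : 0 ≤ primeSum g w z :=
  Finset.sum_nonneg fun p hp => (hg p (Finset.mem_filter.mp (Finset.mem_filter.mp hp).1).2).1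

/-- `2 ≤ w`, `w³ ≤ Δ` ⇒ `1 < Δ`. [folklore] -/
private theorem one_lt_of_cube_le {w Δ : ℝ} (hw : 2 ≤ w) (hΔ : w ^ 3 ≤ Δ) : 1 < Δ := by
  have hw1 : 1 < w := by linarith
  have hw3 : w ≤ w ^ 3 := by simpa using pow_le_pow_right₀ hw1.le (show 1 ≤ 3 by norm_num)
  linarith

/-! ### The three estimates behind Lemma 2.1 -/

/-- Inner bound for the primes `w < p < z`: `Σ♭_{d≤Δ,(d,p)=1} h(d) min(log p, log(Δ/d))² ≤ K`
(drop the coprimality, `min ≤ log(Δ/d)`). [cite: FriedlanderIwaniec2023SelbergIrregular, §2 (2.16)–(2.18)] -/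
theorem inner_le_K (hg : IsDensity g) {Δ : ℝ} (hΔ : 0 ≤ Δ) {p : ℕ} (hp : 1 ≤ p) :
    ∑ d ∈ (sqf Δ).filter (fun d : ℕ => Nat.Coprime d p),
        hWeight g d * min (Real.log p) (Real.log (Δ / d)) ^ 2 ≤ K g Δ := by
  have hlogp : 0 ≤ Real.log p := Real.log_nonneg (by exact_mod_cast hp)
  calc ∑ d ∈ (sqf Δ).filter (fun d : ℕ => Nat.Coprime d p),
        hWeight g d * min (Real.log p) (Real.log (Δ / d)) ^ 2
      ≤ ∑ d ∈ (sqf Δ).filter (fun d : ℕ => Nat.Coprime d p), hWeight g d * Real.log (Δ / d) ^ 2 := by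
        apply Finset.sum_le_sum
        intro d hd
        have hd' : d ∈ sqf Δ := (Finset.mem_filter.mp hd).1
        apply mul_le_mul_of_nonneg_left _ (hWeight_nonneg hg d)
        exact pow_le_pow_left₀ (le_min hlogp (log_div_nonneg hΔ hd')) (min_le_right _ _) 2
    _ ≤ K g Δ := Finset.sum_le_sum_of_subset_of_nonneg (Finset.filter_subset _ _)
        (fun d _ _ => mul_nonneg (hWeight_nonneg hg d) (sq_nonneg _))

/-- Inner bound for the primes `p ≤ w`: `Σ♭_{d≤Δ,(d,p)=1} h(d) min(log p, log(Δ/d))² ≤ (log p)² J`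
(`min ≤ log p`). [cite: FriedlanderIwaniec2023SelbergIrregular, §2 (2.16)–(2.18)] -/
theorem inner_le_sq_log_mul_J (hg : IsDensity g) {Δ : ℝ} (hΔ : 0 ≤ Δ) {p : ℕ} (hp : 1 ≤ p) :
    ∑ d ∈ (sqf Δ).filter (fun d : ℕ => Nat.Coprime d p),
        hWeight g d * min (Real.log p) (Real.log (Δ / d)) ^ 2 ≤ Real.log p ^ 2 * J g Δ := by
  have hlogp : 0 ≤ Real.log p := Real.log_nonneg (by exact_mod_cast hp)
  calc ∑ d ∈ (sqf Δ).filter (fun d : ℕ => Nat.Coprime d p),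
        hWeight g d * min (Real.log p) (Real.log (Δ / d)) ^ 2
      ≤ ∑ d ∈ (sqf Δ).filter (fun d : ℕ => Nat.Coprime d p), hWeight g d * Real.log p ^ 2 := by
        apply Finset.sum_le_sum
        intro d hd
        have hd' : d ∈ sqf Δ := (Finset.mem_filter.mp hd).1
        apply mul_le_mul_of_nonneg_left _ (hWeight_nonneg hg d)
        exact pow_le_pow_left₀ (le_min hlogp (log_div_nonneg hΔ hd')) (min_le_left _ _) 2
    _ ≤ ∑ d ∈ sqf Δ, hWeight g d * Real.log p ^ 2 :=
        Finset.sum_le_sum_of_subset_of_nonneg (Finset.filter_subset _ _)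
          (fun d _ _ => mul_nonneg (hWeight_nonneg hg d) (sq_nonneg _))
    _ = Real.log p ^ 2 * J g Δ := by rw [J, Finset.mul_sum]; congr 1; ext d; ring

/-- The repaired step (module docstring, Reading 2): `Σ♭_{d≤w} h(d) · (log Δ − log w)² ≤ K(w²)`
(for `d ≤ w`: `log(Δ/d) ≥ log Δ − log w ≥ 0`, and `d ≤ w ≤ w²`).
[cite: FriedlanderIwaniec2023SelbergIrregular, §2 (2.18)–(2.20)] -/
theorem Jle_mul_sq_le_Kle (hg : IsDensity g) {w Δ : ℝ} (hw : 1 ≤ w) (hwΔ : w ≤ Δ) :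
    Jle g w Δ * (Real.log Δ - Real.log w) ^ 2 ≤ Kle g Δ (w ^ 2) := by
  have hw0 : 0 < w := by linarith
  have hΔ0 : 0 < Δ := by linarith
  have hLl : 0 ≤ Real.log Δ - Real.log w := sub_nonneg.mpr (Real.log_le_log hw0 hwΔ)
  rw [Jle, Finset.sum_mul]
  calc ∑ d ∈ (sqf Δ).filter (fun d : ℕ => ¬ w < (d : ℝ)), hWeight g d * (Real.log Δ - Real.log w) ^ 2
      ≤ ∑ d ∈ (sqf Δ).filter (fun d : ℕ => ¬ w < (d : ℝ)), hWeight g d * Real.log (Δ / d) ^ 2 := by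
        apply Finset.sum_le_sum
        intro d hd
        obtain ⟨hd', hdw⟩ := Finset.mem_filter.mp hd
        have hdw' : (d : ℝ) ≤ w := not_lt.mp hdw
        have hd1 : (1 : ℝ) ≤ d := by exact_mod_cast one_le_of_mem_sqf hd'
        apply mul_le_mul_of_nonneg_left _ (hWeight_nonneg hg d)
        apply pow_le_pow_left₀ hLl
        rw [Real.log_div hΔ0.ne' (by linarith)]
        linarith [Real.log_le_log (by linarith) hdw']
    _ ≤ Kle g Δ (w ^ 2) := by
        apply Finset.sum_le_sum_of_subset_of_nonneg
        · intro d hd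
          obtain ⟨hd', hdw⟩ := Finset.mem_filter.mp hd
          refine Finset.mem_filter.mpr ⟨hd', ?_⟩
          have hdw' : (d : ℝ) ≤ w := not_lt.mp hdw
          nlinarith
        · intro d _ _
          exact mul_nonneg (hWeight_nonneg hg d) (sq_nonneg _)

/-- **The bound for the prime sum of (2.16)** (Lemma 2.1 in `T`-form, with the repaired step, under
Assumption 1): for `2 ≤ w < z`, `w³ ≤ Δ`,
`T ≤ (Σ_{w<p≤z} g(p)) K + (9/2) α² K(w²) + J(w, Δ) G(w)`.
[cite: FriedlanderIwaniec2023SelbergIrregular, §2 Lemma 2.1 (2.22) with §3 (3.1)] -/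
theorem T_le (hg : IsDensity g) {w z Δ : ℝ} (hw : 2 ≤ w) (hΔ : w ^ 3 ≤ Δ)
    (h1 : Assumption1 g w) :
    T g Δ z ≤ primeSum g w z * K g Δ + 9 / 2 * alpha w Δ ^ 2 * Kle g Δ (w ^ 2) +
      Jtail g w Δ * G g w := by
  have hw1 : 1 < w := by linarith
  have hw0 : 0 < w := by linarith
  have hw3 : w ≤ w ^ 3 := by simpa using pow_le_pow_right₀ hw1.le (show 1 ≤ 3 by norm_num)
  have hwΔ : w ≤ Δ := hw3.trans hΔ
  have hΔ1 : 1 < Δ := by linarith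
  have hΔ0 : 0 ≤ Δ := by linarith
  set ℓ := Real.log w with hℓ
  set L := Real.log Δ with hL
  have hℓpos : 0 < ℓ := Real.log_pos hw1
  have hLpos : 0 < L := Real.log_pos hΔ1
  -- `3ℓ ≤ L`
  have h3ℓ : 3 * ℓ ≤ L := by
    have : Real.log (w ^ 3) ≤ Real.log Δ := Real.log_le_log (by positivity) hΔ
    rwa [Real.log_pow, Nat.cast_ofNat] at this
  have hK0 : 0 ≤ K g Δ := (K_pos hg hΔ1).le
  -- split `T` at `p ≤ w`
  have hsplit := (Finset.sum_filter_add_sum_filter_not (primesLt z) (fun p : ℕ => (p : ℝ) ≤ w)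
    (fun p => g p * ∑ d ∈ (sqf Δ).filter (fun d : ℕ => Nat.Coprime d p),
      hWeight g d * min (Real.log p) (Real.log (Δ / d)) ^ 2)).symm
  rw [T, hsplit]
  -- the primes `w < p < z`
  have hbig : ∑ p ∈ (primesLt z).filter (fun p : ℕ => ¬ (p : ℝ) ≤ w),
      g p * ∑ d ∈ (sqf Δ).filter (fun d : ℕ => Nat.Coprime d p),
        hWeight g d * min (Real.log p) (Real.log (Δ / d)) ^ 2 ≤ primeSum g w z * K g Δ := by
    calc ∑ p ∈ (primesLt z).filter (fun p : ℕ => ¬ (p : ℝ) ≤ w),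
          g p * ∑ d ∈ (sqf Δ).filter (fun d : ℕ => Nat.Coprime d p),
            hWeight g d * min (Real.log p) (Real.log (Δ / d)) ^ 2
        ≤ ∑ p ∈ (primesLt z).filter (fun p : ℕ => ¬ (p : ℝ) ≤ w), g p * K g Δ := by
          apply Finset.sum_le_sum
          intro p hp
          have hpr : p.Prime := (Finset.mem_filter.mp (Finset.mem_filter.mp hp).1).2
          exact mul_le_mul_of_nonneg_left (inner_le_K hg hΔ0 hpr.one_lt.le) (hg p hpr).1
      _ ≤ ∑ p ∈ (primesLe z).filter (fun p : ℕ => w < (p : ℝ)), g p * K g Δ := by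
          apply Finset.sum_le_sum_of_subset_of_nonneg
          · intro p hp
            obtain ⟨hp1, hpw⟩ := Finset.mem_filter.mp hp
            obtain ⟨hpz, hpr⟩ := Finset.mem_filter.mp hp1
            have hpz' : (p : ℝ) < z := Nat.lt_ceil.mp (Finset.mem_range.mp hpz)
            refine Finset.mem_filter.mpr ⟨Finset.mem_filter.mpr ⟨Finset.mem_Icc.mpr
              ⟨hpr.one_lt.le, Nat.le_floor hpz'.le⟩, hpr⟩, not_le.mp hpw⟩
          · intro p hp _
            exact mul_nonneg (hg p (Finset.mem_filter.mp (Finset.mem_filter.mp hp).1).2).1 hK0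
      _ = primeSum g w z * K g Δ := by rw [primeSum, Finset.sum_mul]
  -- the primes `p ≤ w`
  have hsmall : ∑ p ∈ (primesLt z).filter (fun p : ℕ => (p : ℝ) ≤ w),
      g p * ∑ d ∈ (sqf Δ).filter (fun d : ℕ => Nat.Coprime d p),
        hWeight g d * min (Real.log p) (Real.log (Δ / d)) ^ 2 ≤ G g w * J g Δ := by
    calc ∑ p ∈ (primesLt z).filter (fun p : ℕ => (p : ℝ) ≤ w),
          g p * ∑ d ∈ (sqf Δ).filter (fun d : ℕ => Nat.Coprime d p),
            hWeight g d * min (Real.log p) (Real.log (Δ / d)) ^ 2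
        ≤ ∑ p ∈ (primesLt z).filter (fun p : ℕ => (p : ℝ) ≤ w), g p * (Real.log p ^ 2 * J g Δ) := by
          apply Finset.sum_le_sum
          intro p hp
          have hpr : p.Prime := (Finset.mem_filter.mp (Finset.mem_filter.mp hp).1).2
          exact mul_le_mul_of_nonneg_left (inner_le_sq_log_mul_J hg hΔ0 hpr.one_lt.le) (hg p hpr).1
      _ ≤ ∑ p ∈ primesLe w, g p * (Real.log p ^ 2 * J g Δ) := by
          apply Finset.sum_le_sum_of_subset_of_nonneg
          · intro p hp
            obtain ⟨hp1, hpw⟩ := Finset.mem_filter.mp hp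
            obtain ⟨-, hpr⟩ := Finset.mem_filter.mp hp1
            exact Finset.mem_filter.mpr ⟨Finset.mem_Icc.mpr ⟨hpr.one_lt.le, Nat.le_floor hpw⟩, hpr⟩
          · intro p hp _
            have hpr : p.Prime := (Finset.mem_filter.mp hp).2
            exact mul_nonneg (hg p hpr).1 (mul_nonneg (sq_nonneg _)
              (Finset.sum_nonneg fun d _ => hWeight_nonneg hg d))
      _ = G g w * J g Δ := by rw [G, Finset.sum_mul]; congr 1; ext p; ring
  -- the repaired step: `G · Σ♭_{d≤w} h ≤ (9/2) α² K(w²)`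
  have hJle := Jle_mul_sq_le_Kle hg hw1.le hwΔ
  have hJle0 := Jle_nonneg hg w Δ
  have hKle0 := Kle_nonneg hg Δ (w ^ 2)
  have hG0 : 0 ≤ G g w := Finset.sum_nonneg fun p hp =>
    mul_nonneg (hg p (Finset.mem_filter.mp hp).2).1 (sq_nonneg _)
  have hGle : G g w ≤ 3 / 2 * ℓ ^ 2 := h1
  have hstep : G g w * Jle g w Δ ≤ 9 / 2 * alpha w Δ ^ 2 * Kle g Δ (w ^ 2) := by
    rw [alpha, div_pow]
    -- `Jle · L² ≤ (9/4) K(w²)` since `(L − ℓ)² ≥ (4/9) L²`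
    have hLℓ : 4 / 9 * L ^ 2 ≤ (L - ℓ) ^ 2 := by nlinarith
    have hJL : Jle g w Δ * L ^ 2 ≤ 9 / 4 * Kle g Δ (w ^ 2) := by nlinarith
    rw [show 9 / 2 * (ℓ ^ 2 / L ^ 2) * Kle g Δ (w ^ 2) = (9 / 2 * ℓ ^ 2 * Kle g Δ (w ^ 2)) / L ^ 2 by
      field_simp]
    rw [le_div_iff₀ (by positivity)]
    have hm : G g w * (Jle g w Δ * L ^ 2) ≤ 3 / 2 * ℓ ^ 2 * (Jle g w Δ * L ^ 2) :=
      mul_le_mul_of_nonneg_right hGle (mul_nonneg hJle0 (sq_nonneg L))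
    calc G g w * Jle g w Δ * L ^ 2 = G g w * (Jle g w Δ * L ^ 2) := by ring
      _ ≤ 3 / 2 * ℓ ^ 2 * (Jle g w Δ * L ^ 2) := hm
      _ ≤ 3 / 2 * ℓ ^ 2 * (9 / 4 * Kle g Δ (w ^ 2)) := by gcongr
      _ ≤ 9 / 2 * ℓ ^ 2 * Kle g Δ (w ^ 2) := by nlinarith [sq_nonneg ℓ]
  -- assemble
  have hJ : J g Δ = Jle g w Δ + Jtail g w Δ := J_eq_Jle_add_Jtail w Δ
  calc _ ≤ G g w * J g Δ + primeSum g w z * K g Δ := add_le_add hsmall hbig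
    _ = primeSum g w z * K g Δ + G g w * Jle g w Δ + Jtail g w Δ * G g w := by rw [hJ]; ring
    _ ≤ _ := by linarith

/-- **Friedlander–Iwaniec 2023, Lemma 2.1 (PROVED, under Assumption 1 — see Reading 2).** For
`2 ≤ w < z`, `w³ ≤ Δ`, a density `g` with (1.4) and (3.1):
`H² W ≥ (1 − Σ_{w<p≤z} g(p)) K − (9/2) α² K(w²) − J(w, Δ) G(w)`.
[cite: FriedlanderIwaniec2023SelbergIrregular, §2 Lemma 2.1 (2.22)] -/
theorem lemma21 (hg : IsDensity g) {w z Δ : ℝ} (hw : 2 ≤ w) (hΔ : w ^ 3 ≤ Δ)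
    (h1 : Assumption1 g w) :
    (1 - primeSum g w z) * K g Δ - 9 / 2 * alpha w Δ ^ 2 * Kle g Δ (w ^ 2) - Jtail g w Δ * G g w ≤
      H g Δ ^ 2 * W g Δ z := by
  have hΔ1 : 1 < Δ := one_lt_of_cube_le hw hΔ
  have hH : 0 < H g Δ := H_pos hg hΔ1
  have hHW : H g Δ ^ 2 * W g Δ z = K g Δ - T g Δ z := by
    rw [W, mul_div_cancel₀ _ (pow_ne_zero 2 hH.ne')]
  rw [hHW]
  have := T_le (z := z) hg hw hΔ h1
  linarith

/-- **Friedlander–Iwaniec 2023, (3.5) (PROVED): `H² W ≥ ν K`** under Assumptions 1 and 2.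
[cite: FriedlanderIwaniec2023SelbergIrregular, §3 (3.4)–(3.6)] -/
theorem nu_mul_K_le (hg : IsDensity g) {w z Δ : ℝ} (hw : 2 ≤ w) (hΔ : w ^ 3 ≤ Δ)
    (h1 : Assumption1 g w) (h2 : Assumption2 g w Δ) :
    nu g w z Δ * K g Δ ≤ H g Δ ^ 2 * W g Δ z := by
  have hw1 : 1 < w := by linarith
  have hΔ1 : 1 < Δ := one_lt_of_cube_le hw hΔ
  set ℓ := Real.log w with hℓ
  set L := Real.log Δ with hL
  have hℓpos : 0 < ℓ := Real.log_pos hw1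
  have hLpos : 0 < L := Real.log_pos hΔ1
  have hlem := lemma21 (z := z) hg hw hΔ h1
  -- `J(w,Δ) G(w) ≤ (9/2) α² K(w², Δ)` from (3.1) and (3.3)
  have hG0 : 0 ≤ G g w := Finset.sum_nonneg fun p hp =>
    mul_nonneg (hg p (Finset.mem_filter.mp hp).2).1 (sq_nonneg _)
  have hJt0 := Jtail_nonneg hg w Δ
  have hKgt0 := Kgt_nonneg hg Δ (w ^ 2)
  have h34 : Jtail g w Δ * G g w ≤ 9 / 2 * alpha w Δ ^ 2 * Kgt g Δ (w ^ 2) := by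
    have hA1 : G g w ≤ 3 / 2 * ℓ ^ 2 := h1
    have hA2 : Jtail g w Δ * L ^ 2 ≤ 3 * Kgt g Δ (w ^ 2) := h2
    rw [alpha, div_pow,
      show 9 / 2 * (ℓ ^ 2 / L ^ 2) * Kgt g Δ (w ^ 2) = (9 / 2 * ℓ ^ 2 * Kgt g Δ (w ^ 2)) / L ^ 2 by
        field_simp, le_div_iff₀ (by positivity)]
    calc Jtail g w Δ * G g w * L ^ 2 ≤ Jtail g w Δ * (3 / 2 * ℓ ^ 2) * L ^ 2 := by gcongr
      _ = 3 / 2 * ℓ ^ 2 * (Jtail g w Δ * L ^ 2) := by ring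
      _ ≤ 3 / 2 * ℓ ^ 2 * (3 * Kgt g Δ (w ^ 2)) := by gcongr
      _ = 9 / 2 * ℓ ^ 2 * Kgt g Δ (w ^ 2) := by ring
  have hK : K g Δ = Kle g Δ (w ^ 2) + Kgt g Δ (w ^ 2) := K_eq_Kle_add_Kgt Δ (w ^ 2)
  rw [nu]
  calc (1 - primeSum g w z - 9 / 2 * alpha w Δ ^ 2) * K g Δ
      = (1 - primeSum g w z) * K g Δ - 9 / 2 * alpha w Δ ^ 2 * Kle g Δ (w ^ 2) -
          9 / 2 * alpha w Δ ^ 2 * Kgt g Δ (w ^ 2) := by rw [hK]; ring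
    _ ≤ (1 - primeSum g w z) * K g Δ - 9 / 2 * alpha w Δ ^ 2 * Kle g Δ (w ^ 2) -
          Jtail g w Δ * G g w := by linarith
    _ ≤ H g Δ ^ 2 * W g Δ z := hlem

/-- Cauchy's inequality `H² ≤ J K` (weights `h(d) ≥ 0`).
[cite: FriedlanderIwaniec2023SelbergIrregular, §2 (after (2.17)) and §3 (proof of Theorem 1)] -/
theorem H_sq_le_J_mul_K (hg : IsDensity g) (Δ : ℝ) : H g Δ ^ 2 ≤ J g Δ * K g Δ := by
  rw [H, J, K]
  refine Finset.sum_sq_le_sum_mul_sum_of_sq_le_mul (sqf Δ)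
    (fun d _ => hWeight_nonneg hg d) (fun d _ => mul_nonneg (hWeight_nonneg hg d) (sq_nonneg _)) ?_
  intro d _
  exact le_of_eq (by ring)

/-- **Friedlander–Iwaniec 2023, THEOREM 1 (PROVED).** "Let `Δ ≥ w³` and `g(d)` be such that (3.1) and
(3.3) hold. If `z > w` and `ν > 0`, then `J W ≥ ν`." Here `2 ≤ w` (standing from Lemma 2.1), `g`
satisfies (1.4), `J = Σ♭_{d≤Δ} h(d)` (Reading 1), `W` as in (2.16). (The printed hypothesis `z > w` is
not needed for the inequality itself — for `z ≤ w` the sum `Σ_{w<p≤z}` is empty — and is omitted.)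
[cite: FriedlanderIwaniec2023SelbergIrregular, §3 Theorem 1 (3.7)] -/
theorem theorem1 (hg : IsDensity g) {w z Δ : ℝ} (hw : 2 ≤ w) (hΔ : w ^ 3 ≤ Δ)
    (h1 : Assumption1 g w) (h2 : Assumption2 g w Δ) (hν : 0 < nu g w z Δ) :
    nu g w z Δ ≤ J g Δ * W g Δ z := by
  have hΔ1 : 1 < Δ := one_lt_of_cube_le hw hΔ
  have hK := K_pos hg hΔ1
  have hH := H_pos hg hΔ1
  have hmain := nu_mul_K_le (z := z) hg hw hΔ h1 h2
  have hCS := H_sq_le_J_mul_K hg Δ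
  -- `W > 0`
  have hW : 0 < W g Δ z := by
    have : 0 < H g Δ ^ 2 * W g Δ z := lt_of_lt_of_le (mul_pos hν hK) hmain
    exact pos_of_mul_pos_right this (sq_nonneg _)
  -- `ν K ≤ H² W ≤ J K W`
  have h3 : nu g w z Δ * K g Δ ≤ J g Δ * W g Δ z * K g Δ := by
    calc nu g w z Δ * K g Δ ≤ H g Δ ^ 2 * W g Δ z := hmain
      _ ≤ J g Δ * K g Δ * W g Δ z := mul_le_mul_of_nonneg_right hCS hW.le
      _ = J g Δ * W g Δ z * K g Δ := by ring
  exact le_of_mul_le_mul_right h3 hK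

/-- Under the hypotheses of Theorem 1, `W > 0` ("Then `W` is positive").
[cite: FriedlanderIwaniec2023SelbergIrregular, §3 (before Theorem 1)] -/
theorem W_pos (hg : IsDensity g) {w z Δ : ℝ} (hw : 2 ≤ w) (hΔ : w ^ 3 ≤ Δ)
    (h1 : Assumption1 g w) (h2 : Assumption2 g w Δ) (hν : 0 < nu g w z Δ) : 0 < W g Δ z := by
  have hΔ1 : 1 < Δ := one_lt_of_cube_le hw hΔ
  have : 0 < H g Δ ^ 2 * W g Δ z :=
    lt_of_lt_of_le (mul_pos hν (K_pos hg hΔ1)) (nu_mul_K_le (z := z) hg hw hΔ h1 h2)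
  exact pos_of_mul_pos_right this (sq_nonneg _)

/-! ### (1.9): `J ≤ ∏ (1 + h(p)) = V⁻¹`, and the `W`-form of Theorem 1 -/

/-- The product `∏_{p ≤ Δ} (1 − g(p))` is positive under (1.4).
[cite: FriedlanderIwaniec2023SelbergIrregular, §1 (1.10)] -/
theorem prod_one_sub_pos (hg : IsDensity g) (Δ : ℝ) : 0 < ∏ p ∈ primesLe Δ, (1 - g p) :=
  Finset.prod_pos fun p hp => by
    have := (hg p (Finset.mem_filter.mp hp).2).2
    linarith

/-- **(1.9): `J ≤ ∏_{p≤Δ} (1 + h(p)) = (∏_{p≤Δ} (1 − g(p)))⁻¹`** (expand the product over subsets of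
the primes `≤ Δ`; the squarefree `d ≤ Δ` inject by `d ↦ {p ∣ d}`).
[cite: FriedlanderIwaniec2023SelbergIrregular, §1 (1.9)–(1.10)] -/
theorem J_le_inv_prod (hg : IsDensity g) (Δ : ℝ) :
    J g Δ ≤ (∏ p ∈ primesLe Δ, (1 - g p))⁻¹ := by
  classical
  -- `∏ (1 − g p)⁻¹ = ∏ (1 + h p) = Σ_{t ⊆ P} ∏_{p ∈ t} h p`
  have hfac : ∀ p ∈ primesLe Δ, (1 - g p)⁻¹ = 1 + g p / (1 - g p) := by
    intro p hp
    have h1 : 0 < 1 - g p := by have := (hg p (Finset.mem_filter.mp hp).2).2; linarith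
    field_simp
    ring
  rw [← Finset.prod_inv_distrib, Finset.prod_congr rfl hfac, Finset.prod_one_add]
  -- `J` as a sum over the image of `d ↦ d.primeFactors`
  have hinj : Set.InjOn (fun d : ℕ => d.primeFactors) (sqf Δ : Set ℕ) := by
    intro d₁ hd₁ d₂ hd₂ heq
    have h₁ := Nat.prod_primeFactors_of_squarefree (mem_sqf.mp (Finset.mem_coe.mp hd₁)).2
    have h₂ := Nat.prod_primeFactors_of_squarefree (mem_sqf.mp (Finset.mem_coe.mp hd₂)).2
    rw [← h₁, ← h₂]
    exact congrArg (fun s : Finset ℕ => ∏ p ∈ s, p) heq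
  have hJ : J g Δ = ∑ t ∈ (sqf Δ).image (fun d : ℕ => d.primeFactors), ∏ p ∈ t, g p / (1 - g p) := by
    rw [J, Finset.sum_image hinj]
    rfl
  rw [hJ]
  apply Finset.sum_le_sum_of_subset_of_nonneg
  · intro t ht
    obtain ⟨d, hd, rfl⟩ := Finset.mem_image.mp ht
    rw [Finset.mem_powerset]
    intro p hp
    have hpr := Nat.prime_of_mem_primeFactors hp
    have hpd : p ≤ d := Nat.le_of_dvd (one_le_of_mem_sqf hd) (Nat.dvd_of_mem_primeFactors hp)
    exact Finset.mem_filter.mpr ⟨Finset.mem_Icc.mpr ⟨hpr.one_lt.le,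
      hpd.trans (mem_sqf.mp hd).1.2⟩, hpr⟩
  · intro t ht _
    refine Finset.prod_nonneg fun p hp => ?_
    have hpr : p.Prime := (Finset.mem_filter.mp (Finset.mem_powerset.mp ht hp)).2
    obtain ⟨h0, h1⟩ := hg p hpr
    exact div_nonneg h0 (by linarith)

/-- **Theorem 1 in `W`-form: `W ≥ ν · ∏_{p≤Δ} (1 − g(p))`** (from `J W ≥ ν`, `W > 0` and (1.9)).
[cite: FriedlanderIwaniec2023SelbergIrregular, §3 Theorem 1 with §1 (1.9)–(1.10)] -/
theorem theorem1_W_ge (hg : IsDensity g) {w z Δ : ℝ} (hw : 2 ≤ w) (hΔ : w ^ 3 ≤ Δ)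
    (h1 : Assumption1 g w) (h2 : Assumption2 g w Δ) (hν : 0 < nu g w z Δ) :
    nu g w z Δ * ∏ p ∈ primesLe Δ, (1 - g p) ≤ W g Δ z := by
  have hV := prod_one_sub_pos hg Δ
  have hW := W_pos hg hw hΔ h1 h2 hν
  have hJ := J_le_inv_prod hg Δ
  have h := theorem1 hg hw hΔ h1 h2 hν
  have h' : nu g w z Δ ≤ (∏ p ∈ primesLe Δ, (1 - g p))⁻¹ * W g Δ z :=
    h.trans (mul_le_mul_of_nonneg_right hJ hW.le)
  rwa [← div_eq_inv_mul, le_div_iff₀ hV] at h'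

/-- `α = 1/3` when `Δ = w³` (`w > 1`). [cite: FriedlanderIwaniec2023SelbergIrregular, §5 (5.3) ("ν = 1 − δ − 1/2")] -/
theorem alpha_cube {w : ℝ} (hw : 1 < w) : alpha w (w ^ 3) = 1 / 3 := by
  have hℓ : 0 < Real.log w := Real.log_pos hw
  rw [alpha, Real.log_pow, Nat.cast_ofNat]
  field_simp

/-- **Friedlander–Iwaniec 2023, §5 (5.2)–(5.4) (PROVED): with `Δ = w³`, `z > w` and the
"exceptional" condition `δ(w, z) = Σ_{w<p≤z} g(p) ≤ 1/4` (Assumption 3), `ν = 1 − δ − 1/2 ≥ 1/4`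
and `W ≥ (1/4) V`, `V = ∏_{p ≤ w³} (1 − g(p))`** (the printed `V` is over `p < w³`; equal unless `w³`
is prime). [cite: FriedlanderIwaniec2023SelbergIrregular, §5 (5.2)–(5.4)] -/
theorem W_ge_quarter_prod (hg : IsDensity g) {w z : ℝ} (hw : 2 ≤ w) 
    (h1 : Assumption1 g w) (h2 : Assumption2 g w (w ^ 3)) (h3 : primeSum g w z ≤ 1 / 4) :
    1 / 4 * ∏ p ∈ primesLe (w ^ 3), (1 - g p) ≤ W g (w ^ 3) z := by
  have hα : alpha w (w ^ 3) = 1 / 3 := alpha_cube (by linarith)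
  have hν : 1 / 4 ≤ nu g w z (w ^ 3) := by
    rw [nu, hα]; norm_num; linarith
  have hν0 : 0 < nu g w z (w ^ 3) := by linarith
  have h := theorem1_W_ge hg hw le_rfl h1 h2 hν0
  have hV := prod_one_sub_pos hg (w ^ 3)
  calc 1 / 4 * ∏ p ∈ primesLe (w ^ 3), (1 - g p)
      ≤ nu g w z (w ^ 3) * ∏ p ∈ primesLe (w ^ 3), (1 - g p) :=
        mul_le_mul_of_nonneg_right hν hV.le
    _ ≤ W g (w ^ 3) z := h

/-- The printed form of Lemma 2.1's first sum, `Σ_{w<p≤z}`, dominates our `Σ_{w<p<z}`; stated for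
completeness: with the `≤ z` sum the bound (2.22) is the one proved in `lemma21`.
[cite: FriedlanderIwaniec2023SelbergIrregular, §2 (2.22)] -/
theorem lemma21' (hg : IsDensity g) {w z Δ : ℝ} (hw : 2 ≤ w) (hΔ : w ^ 3 ≤ Δ)
    (h1 : Assumption1 g w) :
    (1 - primeSum g w z) * K g Δ - 9 / 2 * alpha w Δ ^ 2 * Kle g Δ (w ^ 2) - Jtail g w Δ * G g w ≤
      K g Δ - T g Δ z := by
  have hΔ1 : 1 < Δ := one_lt_of_cube_le hw hΔ
  have hH : 0 < H g Δ := H_pos hg hΔ1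
  have h := lemma21 (z := z) hg hw hΔ h1
  rwa [W, mul_div_cancel₀ _ (pow_ne_zero 2 hH.ne')] at h

end SelbergIrregular

end Literature.NumberTheory.Sieve

end
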